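import Mathlib
import HarnessLib
import Summits.HubbardSuperconductivity.HubbardSuperconductivity.Theorems.KLProgrammeC4aPartnerBandCooperChord
import Summits.HubbardSuperconductivity.HubbardSuperconductivity.Theorems.KLProgrammeC4aAbsBubbleLevelLoop

/-!
# Route `KLProgramme` — crux C4a, S3 brick (B4)/(B5) «(B4)-DIRECT-PACK», part 3: the absolute-bubble `level × loop` bound FOR THE ACTUAL PARTNER BAND —
# `…C4aAbsBubbleLevelLoop` instantiated on `G e φ = e_K(S − Φ(e,φ+θ))` with FrameOK-only constants (transversal class sheet-uniform; Cooper class keyed on the chord)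

Cell `gate-hubbard-kl`, seat hubbard-kl-k3c3-p3 (g27; row «implicit-function / monotonicity route for μ(n)»).  Located brick for the (C)-closer lane
hubbard-kl-c4a-1 (stub (C) `stub_twoLeg_curvature` of `KLRegimeEngineV17F2`, stmt-HubbardSuperconductivity-20437), B4-ABS-BUBBLE.md §3 row (r4) «uniform-in-`(e,φ)`
packaging of `hdich`/`hL`», memo HOME/hubbard-kl-k3c3-p3/B4-DIRECT-PACK.md §3.

The carrier-free theorems of `…C4aAbsBubbleLevelLoop` take a LEVEL FAMILY `G : ℝ → ℝ → ℝ` with uniform regularity, slope ceiling and dichotomy hypotheses.  Here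
`G e φ := e_K(S − Φ(e, φ+θ))` is the pp PARTNER BAND of the co-moving loop at the configuration `(ρ,ϑ,θ)` (`S = Φ(0,θ) + Φ(ρ,ϑ+θ)`), and those hypotheses are
DISCHARGED from clause (i) of `FrameOK` (Sizes binder shape + `GeomConstants` + the `K₁, K₂` rows):
* §1 `contDiff_partnerBand_pp_angle` (`C¹` in the loop angle), `abs_deriv_partnerBand_pp_angle_le` (GENERIC slope ceiling `|∂_φē| ≤ K₁·msD₁`), `msD_one_pos`.
* §2 **`level_loop_partnerBand_le_transversal`** (TRANSVERSAL class, sheet-uniform): on a loop piece `[a′,b′]` whose points avoid every tangency corner / umklapp caustic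
  at scale `(λ,ε)` (`msD₁τ(λ,ε) + (2hi+ε)/(Dt−2A) < ‖S − 2πm − 2Φ(0,φ+θ)‖`, all `m`), at a configuration not `(λ,ε)`-Cooper relative to any sheet
  (`msD₁τ(λ,ε) + ε/(Dt−2A) < ‖S − 2πm‖`, all `m`; part 2 discharges `m ≠ 0`), for levels `e ∈ [lo,hi] ⊂ (0, r)` (`hi < r₀`, `hi + ε < r`):
  `∫_{lo..hi} w(e)·(∫_{[a′,b′]} dφ/max(t e, |ē(e,φ)|)) de ≤ W·(2(b′−a′) + 2Nε/λ + (b′−a′)·log⁺(hi/(ε/2)))`, `N` cells with `(b′−a′)·4K₁msD₁ ≤ N·ε` — `lo`-FREE.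
* §3 **`level_loop_partnerBand_le_cooper_chord`** (COOPER class keyed on `s = ‖S‖`, WHOLE loop circle, no located datum): in the window
  `s·X(ĉ₀,ĉ₁) + 2hi/(Dt−2A) + s < min(3/5, 2u_min)`, `X < 1`: `≤ W·(2(b′−a′) + 2Nĉ₀/ĉ₁ + (b′−a′)·log⁺(hi/(ĉ₀s/2)))` with the `s`-FREE cell count
  `(b′−a′)·4K₂msD₁ ≤ N·ĉ₀`; §4 `posLog_chord_le_posLog_torusDist`: `log⁺(hi/(ĉ₀s/2)) ≤ log⁺((πhi/(ĉ₀u_min))/‖ϑ−π‖_𝕋)` — the one logarithm is the integrable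
  Cooper logarithm of the tube angle UNIFORMLY IN `ρ` (`…C4aAbsBubbleLevelLoop.intervalIntegral_cooper_window_le` closes the `ϑ`-layer).
Nothing about the model's sizes beyond clause (i) of `FrameOK`; nothing asserts (C), K3 or superconductivity.  References: Salmhofer 1999 §4.5.3 Lemma 4.10 / Cor. 4.11
[cite: Salmhofer1999]; FST II CPAM 51 (1998) §3 [cite: FeldmanSalmhoferTrubowitz1998]; BGM 2006 §2.4, App. A2 [cite: BenfattoGiulianiMastropietro2006].
-/

noncomputable section

namespace Summit.HubbardSuperconductivity.HubbardSuperconductivity.Theorems.C4a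

set_option linter.dupNamespace false -- summit = problem name (single-conjunct summit), D-0017

open Real Set MeasureTheory
open Literature.MathematicalPhysics.QuantumLattice Literature.MathematicalPhysics.QuantumLattice.BandSectorCounting
open Literature.MathematicalPhysics.QuantumLattice.FermiRG
open Summit.HubbardSuperconductivity.HubbardSuperconductivity.Theorems.KLRegimeSplit
open Summit.HubbardSuperconductivity.HubbardSuperconductivity.Theorems.DispersionFlow
open Summit.HubbardSuperconductivity.HubbardSuperconductivity.Theorems.PerturbedFermiCurve

/-- `msD A₃ A₄ 1 = klCurveD1 > 0`. -/
theorem msD_one_pos (A₃ A₄ : ℝ) : 0 < msD A₃ A₄ 1 := by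
  show 0 < klCurveD1
  unfold klCurveD1 klCurveR1
  have := klCurveD_pos
  positivity

section Sizes

variable {K : TrigPolyC4v} {A : ℝ} (hA : ∀ p : Momentum, ∀ j ≤ 2, ‖iteratedFDeriv ℝ j (frameShift K) p‖ ≤ A) (hA20 : A ≤ 1 / 20)
  (hd : klCurveD ≤ (bandBounds (show (-4 : ℝ) < -1.1 by norm_num) (show (-1.1 : ℝ) ≤ -0.1 by norm_num)
    (show (-0.1 : ℝ) < 0 by norm_num)).Dtmin - 2 * A)
  {μ r : ℝ} (hr : 0 < r) (hlo : (-1.1 : ℝ) < μ - r - A) (hhi : μ + r + A < -0.1)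
  {A₃ A₄ : ℝ} (hA₃ : ∀ p : Momentum, ‖iteratedFDeriv ℝ 3 (frameShift K) p‖ ≤ A₃)
  (hA₄ : ∀ p : Momentum, ‖iteratedFDeriv ℝ 4 (frameShift K) p‖ ≤ A₄)
  {K₁ K₂ : ℝ} (hK₁ : ∀ p : Momentum, ‖fderiv ℝ (frameLevel μ K) p‖ ≤ K₁) (hK₂ : ∀ p : Momentum, ‖iteratedFDeriv ℝ 2 (frameLevel μ K) p‖ ≤ K₂)
include hA hA20 hd hr hlo hhi hA₃ hA₄ hK₁ hK₂

/-! ## §1 Regularity and the generic slope ceiling of the partner band in the loop angle -/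

omit hA20 hr hA₃ hA₄ hK₁ hK₂ in
/-- The partner band `φ ↦ e_K(S − Φ(e,φ+θ))` is `Cⁿ` in the loop angle (`|e| < r`). -/
theorem contDiff_partnerBand_pp_angle (ρ : ℝ) {e : ℝ} (he : |e| < r) (ϑ θ : ℝ) (n : ℕ) :
    ContDiff ℝ n (fun x : ℝ => frameLevel μ K (pairSumPath μ K ρ ϑ θ 0 - levelPoint μ K e (x + θ))) :=
  (EngineV8.contDiff_frameLevel μ K (n := n)).comp
    (contDiff_const.sub ((contDiff_levelPoint_of_sizes hA hd hlo hhi he n).comp (contDiff_id.add contDiff_const)))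

omit hr hK₂ in
/-- **Generic slope ceiling**: `|∂_φ e_K(S − Φ(e,φ+θ))| ≤ K₁·msD₁` at every loop point (`|e| < r`), every configuration. -/
theorem abs_deriv_partnerBand_pp_angle_le (ρ : ℝ) {e : ℝ} (he : |e| < r) (ϑ θ φ : ℝ) :
    |deriv (fun x : ℝ => frameLevel μ K (pairSumPath μ K ρ ϑ θ 0 - levelPoint μ K e (x + θ))) φ| ≤ K₁ * msD A₃ A₄ 1 := by
  rw [(hasDerivAt_partnerBand_pp_angle hA hd hlo hhi (ρ := ρ) he ϑ θ φ).deriv, abs_neg, ← Real.norm_eq_abs]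
  have h1 := hK₁ (pairSumPath μ K ρ ϑ θ 0 - levelPoint μ K e (φ + θ))
  have h2 := norm_iteratedDeriv_levelPoint_le hA hA20 hd hlo hhi hA₃ hA₄ he (i := 1) le_rfl (by norm_num) (φ + θ)
  exact (ContinuousLinearMap.le_opNorm _ _).trans (mul_le_mul h1 h2 (norm_nonneg _) ((norm_nonneg _).trans h1))

/-! ## §2 TRANSVERSAL CLASS for the partner band, sheet-uniform -/

omit hr hK₂ in
/-- **THE ABSOLUTE BUBBLE OVER A TRANSVERSAL LOOP PIECE IS `n`-FREE** (partner band, FrameOK-only constants).  Configuration `(ρ,ϑ,θ)`; loop piece `[a′,b′]`;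
levels `e ∈ [lo,hi]`, `0 < lo ≤ hi`, `hi < r₀`, `hi + ε < r`; thresholds `λ, ε > 0` with `τ = τ(λ,ε)` of part 1; hypotheses: (hC) the configuration is not
`(λ,ε)`-Cooper relative to any sheet, (hT) every point of the piece avoids every tangency corner / umklapp caustic at scale `(λ,ε,hi)`, (hN) `(b′−a′)·4K₁msD₁ ≤ N·ε`;
envelope floors `t e ≥ e`, weight `0 ≤ w ≤ W`.  THEN
`∫_{lo..hi} w(e)·(∫_{[a′,b′]} dφ/max(t e, |e_K(S − Φ(e,φ+θ))|)) de ≤ W·(2(b′−a′) + 2Nε/λ + (b′−a′)·log⁺(hi/(ε/2)))` — independent of `lo`.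
[cite: Salmhofer1999, §4.5.3 Lemma 4.10; FeldmanSalmhoferTrubowitz1998, §3] -/
theorem level_loop_partnerBand_le_transversal {Kc r₀ g₀ w : ℝ} (hG : GeomConstants (frameLevel μ K) Kc r₀ g₀ w) (hK₁0 : 0 < K₁)
    {ρ ϑ θ a' b' lo hi lam eps W : ℝ} {t wt : ℝ → ℝ} {N : ℕ}
    (hab : a' ≤ b') (hlo0 : 0 < lo) (hlohi : lo ≤ hi) (hhir₀ : hi < r₀) (hhir : hi + eps < r) (hlam : 0 < lam) (heps : 0 < eps)
    (hC : ∀ m : Fin 2 → ℤ, msD A₃ A₄ 1 *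
            ((π / 2 * lam /
                  (((bandBounds (show (-4 : ℝ) < -1.1 by norm_num) (show (-1.1 : ℝ) ≤ -0.1 by norm_num) (show (-0.1 : ℝ) < 0 by norm_num)).Dtmin -
                      2 * A) *
                    (bandBounds (show (-4 : ℝ) < -1.1 by norm_num) (show (-1.1 : ℝ) ≤ -0.1 by norm_num) (show (-0.1 : ℝ) < 0 by norm_num)).umin) +
                π * Kc * eps / ((bandBounds (show (-4 : ℝ) < -1.1 by norm_num) (show (-1.1 : ℝ) ≤ -0.1 by norm_num)
                  (show (-0.1 : ℝ) < 0 by norm_num)).Dtmin - 2 * A) ^ 2) /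
              ((bandBounds (show (-4 : ℝ) < -1.1 by norm_num) (show (-1.1 : ℝ) ≤ -0.1 by norm_num) (show (-0.1 : ℝ) < 0 by norm_num)).umin * w /
                (4 + 2 * A))) +
          eps / ((bandBounds (show (-4 : ℝ) < -1.1 by norm_num) (show (-1.1 : ℝ) ≤ -0.1 by norm_num) (show (-0.1 : ℝ) < 0 by norm_num)).Dtmin - 2 * A) <
        ‖pairSumPath μ K ρ ϑ θ 0 - WithLp.toLp 2 (fun i => 2 * π * (m i : ℝ))‖)
    (hT : ∀ φ ∈ Icc a' b', ∀ m : Fin 2 → ℤ, msD A₃ A₄ 1 *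
            ((π / 2 * lam /
                  (((bandBounds (show (-4 : ℝ) < -1.1 by norm_num) (show (-1.1 : ℝ) ≤ -0.1 by norm_num) (show (-0.1 : ℝ) < 0 by norm_num)).Dtmin -
                      2 * A) *
                    (bandBounds (show (-4 : ℝ) < -1.1 by norm_num) (show (-1.1 : ℝ) ≤ -0.1 by norm_num) (show (-0.1 : ℝ) < 0 by norm_num)).umin) +
                π * Kc * eps / ((bandBounds (show (-4 : ℝ) < -1.1 by norm_num) (show (-1.1 : ℝ) ≤ -0.1 by norm_num)
                  (show (-0.1 : ℝ) < 0 by norm_num)).Dtmin - 2 * A) ^ 2) /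
              ((bandBounds (show (-4 : ℝ) < -1.1 by norm_num) (show (-1.1 : ℝ) ≤ -0.1 by norm_num) (show (-0.1 : ℝ) < 0 by norm_num)).umin * w /
                (4 + 2 * A))) +
          (2 * hi + eps) / ((bandBounds (show (-4 : ℝ) < -1.1 by norm_num) (show (-1.1 : ℝ) ≤ -0.1 by norm_num) (show (-0.1 : ℝ) < 0 by norm_num)).Dtmin -
            2 * A) <
        ‖pairSumPath μ K ρ ϑ θ 0 - WithLp.toLp 2 (fun i => 2 * π * (m i : ℝ)) - (2 : ℝ) • levelPoint μ K 0 (φ + θ)‖)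
    (hN : (b' - a') * (4 * (K₁ * msD A₃ A₄ 1)) ≤ N * eps)
    (ht : ∀ e ∈ Icc lo hi, e ≤ t e) (hW : 0 ≤ W) (hw0 : ∀ e ∈ Icc lo hi, 0 ≤ wt e) (hw : ∀ e ∈ Icc lo hi, wt e ≤ W) :
    ∫ e in lo..hi, wt e * ∫ x in Icc a' b', (max (t e) |frameLevel μ K (pairSumPath μ K ρ ϑ θ 0 - levelPoint μ K e (x + θ))|)⁻¹ ≤
      W * (2 * (b' - a') + 2 * (N * eps / lam) + (b' - a') * log⁺ (hi / (eps * 1 / 2))) := by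
  set B := bandBounds (show (-4 : ℝ) < -1.1 by norm_num) (show (-1.1 : ℝ) ≤ -0.1 by norm_num) (show (-0.1 : ℝ) < 0 by norm_num) with hBdef
  have hDt : 0 < B.Dtmin - 2 * A := by have := klCurveD_pos; linarith
  have hM := msD_one_pos A₃ A₄
  -- every level of the window is a tube level
  have heI : ∀ e ∈ Icc lo hi, |e| < r ∧ |e| < r₀ ∧ 0 < e := fun e he => by
    have h0 : 0 < e := hlo0.trans_le he.1
    rw [abs_of_pos h0]
    exact ⟨by linarith [he.2], by linarith [he.2], h0⟩
  refine level_loop_inv_envelope_le_cooper (G := fun e x => frameLevel μ K (pairSumPath μ K ρ ϑ θ 0 - levelPoint μ K e (x + θ)))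
    hab hlo0 hlohi (fun e he => contDiff_partnerBand_pp_angle hA hd hlo hhi ρ (heI e he).1 ϑ θ 1) (η := 1) one_pos heps hlam
    (mul_pos hK₁0 hM) (fun e he x _ => ?_) (fun e he x hx hGe => ?_) (by simpa using hN) ht hW hw0 hw
  · rw [mul_one]; exact abs_deriv_partnerBand_pp_angle_le hA hA20 hd hlo hhi hA₃ hA₄ hK₁ ρ (heI e he).1 ϑ θ x
  · -- the dichotomy at the loop point `(e, x)`: part 1's sheet-uniform row
    obtain ⟨her, her₀, he0⟩ := heI e he
    rw [mul_one] at hGe ⊢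
    have hē : |frameLevel μ K (pairSumPath μ K ρ ϑ θ 0 - levelPoint μ K e (x + θ))| < r := by
      have h1 := abs_le.1 hGe
      have h2 := he.2
      rw [abs_lt]; constructor <;> nlinarith [abs_nonneg e, abs_of_pos he0]
    refine (abs_deriv_partnerBand_pp_angle_gt_of_sheets hA hA20 hd hlo hhi hA₃ hA₄ hG her her₀ hē hGe hC fun m => ?_).le
    have hmono : (2 * |e| + eps) / (B.Dtmin - 2 * A) ≤ (2 * hi + eps) / (B.Dtmin - 2 * A) := by
      refine div_le_div_of_nonneg_right ?_ hDt.le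
      rw [abs_of_pos he0]; linarith [he.2]
    have h := hT x hx m
    linarith

/-! ## §3 COOPER CLASS for the partner band, keyed on the chord `s = ‖S‖` -/

omit hr hK₁ in
/-- **THE ABSOLUTE BUBBLE NEAR THE COOPER CONFIGURATION IS `n`-FREE UP TO ONE LOGARITHM OF THE CHORD** (partner band, FrameOK-only constants, WHOLE loop circle).
Configuration `(ρ,ϑ,θ)` with chord `s = ‖S‖ > 0` in the Cooper window `s·X + 2hi/(Dt−2A) + s < min(3/5, 2u_min)`, `X = X(ĉ₀,ĉ₁) < 1`, `ĉ₀, ĉ₁ > 0`; loop piece `[a′,b′]`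
(any); levels `e ∈ [lo,hi]`, `0 < lo ≤ hi`, `hi < r₀`, `hi + ĉ₀s < r`; `s`-FREE cell count `(b′−a′)·4K₂msD₁ ≤ N·ĉ₀`; envelope floors `t e ≥ e`, weight `0 ≤ w ≤ W`.  THEN
`∫_{lo..hi} w(e)·(∫_{[a′,b′]} dφ/max(t e, |e_K(S − Φ(e,φ+θ))|)) de ≤ W·(2(b′−a′) + 2Nĉ₀/ĉ₁ + (b′−a′)·log⁺(hi/(ĉ₀s/2)))` — independent of `lo`, and of `s` but for
the logarithm. [cite: Salmhofer1999, §4.5.3 Cor. 4.11; FeldmanSalmhoferTrubowitz1998, §3 Thm 3.5] -/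
theorem level_loop_partnerBand_le_cooper_chord {Kc r₀ g₀ w : ℝ} (hG : GeomConstants (frameLevel μ K) Kc r₀ g₀ w) (hK₂0 : 0 < K₂)
    {ρ ϑ θ a' b' lo hi c₀ c₁ W : ℝ} {t wt : ℝ → ℝ} {N : ℕ}
    (hab : a' ≤ b') (hlo0 : 0 < lo) (hlohi : lo ≤ hi) (hhir₀ : hi < r₀) (hhir : hi + c₀ * ‖pairSumPath μ K ρ ϑ θ 0‖ < r)
    (hc₀ : 0 < c₀) (hc₁ : 0 < c₁) (hs : 0 < ‖pairSumPath μ K ρ ϑ θ 0‖)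
    (hX : msD A₃ A₄ 1 *
            ((π / 2 * c₁ /
                  (((bandBounds (show (-4 : ℝ) < -1.1 by norm_num) (show (-1.1 : ℝ) ≤ -0.1 by norm_num) (show (-0.1 : ℝ) < 0 by norm_num)).Dtmin -
                      2 * A) *
                    (bandBounds (show (-4 : ℝ) < -1.1 by norm_num) (show (-1.1 : ℝ) ≤ -0.1 by norm_num) (show (-0.1 : ℝ) < 0 by norm_num)).umin) +
                π * Kc * c₀ / ((bandBounds (show (-4 : ℝ) < -1.1 by norm_num) (show (-1.1 : ℝ) ≤ -0.1 by norm_num)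
                  (show (-0.1 : ℝ) < 0 by norm_num)).Dtmin - 2 * A) ^ 2) /
              ((bandBounds (show (-4 : ℝ) < -1.1 by norm_num) (show (-1.1 : ℝ) ≤ -0.1 by norm_num) (show (-0.1 : ℝ) < 0 by norm_num)).umin * w /
                (4 + 2 * A))) +
          c₀ / ((bandBounds (show (-4 : ℝ) < -1.1 by norm_num) (show (-1.1 : ℝ) ≤ -0.1 by norm_num) (show (-0.1 : ℝ) < 0 by norm_num)).Dtmin - 2 * A) < 1)
    (hwin : ‖pairSumPath μ K ρ ϑ θ 0‖ * (msD A₃ A₄ 1 *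
            ((π / 2 * c₁ /
                  (((bandBounds (show (-4 : ℝ) < -1.1 by norm_num) (show (-1.1 : ℝ) ≤ -0.1 by norm_num) (show (-0.1 : ℝ) < 0 by norm_num)).Dtmin -
                      2 * A) *
                    (bandBounds (show (-4 : ℝ) < -1.1 by norm_num) (show (-1.1 : ℝ) ≤ -0.1 by norm_num) (show (-0.1 : ℝ) < 0 by norm_num)).umin) +
                π * Kc * c₀ / ((bandBounds (show (-4 : ℝ) < -1.1 by norm_num) (show (-1.1 : ℝ) ≤ -0.1 by norm_num)
                  (show (-0.1 : ℝ) < 0 by norm_num)).Dtmin - 2 * A) ^ 2) /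
              ((bandBounds (show (-4 : ℝ) < -1.1 by norm_num) (show (-1.1 : ℝ) ≤ -0.1 by norm_num) (show (-0.1 : ℝ) < 0 by norm_num)).umin * w /
                (4 + 2 * A))) +
          c₀ / ((bandBounds (show (-4 : ℝ) < -1.1 by norm_num) (show (-1.1 : ℝ) ≤ -0.1 by norm_num) (show (-0.1 : ℝ) < 0 by norm_num)).Dtmin - 2 * A)) +
          2 * hi / ((bandBounds (show (-4 : ℝ) < -1.1 by norm_num) (show (-1.1 : ℝ) ≤ -0.1 by norm_num) (show (-0.1 : ℝ) < 0 by norm_num)).Dtmin - 2 * A) +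
          ‖pairSumPath μ K ρ ϑ θ 0‖ < 3 / 5)
    (hwin' : ‖pairSumPath μ K ρ ϑ θ 0‖ * (msD A₃ A₄ 1 *
            ((π / 2 * c₁ /
                  (((bandBounds (show (-4 : ℝ) < -1.1 by norm_num) (show (-1.1 : ℝ) ≤ -0.1 by norm_num) (show (-0.1 : ℝ) < 0 by norm_num)).Dtmin -
                      2 * A) *
                    (bandBounds (show (-4 : ℝ) < -1.1 by norm_num) (show (-1.1 : ℝ) ≤ -0.1 by norm_num) (show (-0.1 : ℝ) < 0 by norm_num)).umin) +
                π * Kc * c₀ / ((bandBounds (show (-4 : ℝ) < -1.1 by norm_num) (show (-1.1 : ℝ) ≤ -0.1 by norm_num)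
                  (show (-0.1 : ℝ) < 0 by norm_num)).Dtmin - 2 * A) ^ 2) /
              ((bandBounds (show (-4 : ℝ) < -1.1 by norm_num) (show (-1.1 : ℝ) ≤ -0.1 by norm_num) (show (-0.1 : ℝ) < 0 by norm_num)).umin * w /
                (4 + 2 * A))) +
          c₀ / ((bandBounds (show (-4 : ℝ) < -1.1 by norm_num) (show (-1.1 : ℝ) ≤ -0.1 by norm_num) (show (-0.1 : ℝ) < 0 by norm_num)).Dtmin - 2 * A)) +
          2 * hi / ((bandBounds (show (-4 : ℝ) < -1.1 by norm_num) (show (-1.1 : ℝ) ≤ -0.1 by norm_num) (show (-0.1 : ℝ) < 0 by norm_num)).Dtmin - 2 * A) +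
          ‖pairSumPath μ K ρ ϑ θ 0‖ <
        2 * (bandBounds (show (-4 : ℝ) < -1.1 by norm_num) (show (-1.1 : ℝ) ≤ -0.1 by norm_num) (show (-0.1 : ℝ) < 0 by norm_num)).umin)
    (hN : (b' - a') * (4 * (K₂ * msD A₃ A₄ 1)) ≤ N * c₀)
    (ht : ∀ e ∈ Icc lo hi, e ≤ t e) (hW : 0 ≤ W) (hw0 : ∀ e ∈ Icc lo hi, 0 ≤ wt e) (hw : ∀ e ∈ Icc lo hi, wt e ≤ W) :
    ∫ e in lo..hi, wt e * ∫ x in Icc a' b', (max (t e) |frameLevel μ K (pairSumPath μ K ρ ϑ θ 0 - levelPoint μ K e (x + θ))|)⁻¹ ≤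
      W * (2 * (b' - a') + 2 * (N * c₀ / c₁) + (b' - a') * log⁺ (hi / (c₀ * ‖pairSumPath μ K ρ ϑ θ 0‖ / 2))) := by
  set B := bandBounds (show (-4 : ℝ) < -1.1 by norm_num) (show (-1.1 : ℝ) ≤ -0.1 by norm_num) (show (-0.1 : ℝ) < 0 by norm_num) with hBdef
  have hDt : 0 < B.Dtmin - 2 * A := by have := klCurveD_pos; linarith
  have hM := msD_one_pos A₃ A₄
  have heI : ∀ e ∈ Icc lo hi, |e| < r ∧ |e| < r₀ ∧ 0 < e := fun e he => by
    have h0 : 0 < e := hlo0.trans_le he.1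
    rw [abs_of_pos h0]
    have : 0 ≤ c₀ * ‖pairSumPath μ K ρ ϑ θ 0‖ := by positivity
    exact ⟨by linarith [he.2], by linarith [he.2], h0⟩
  refine level_loop_inv_envelope_le_cooper (G := fun e x => frameLevel μ K (pairSumPath μ K ρ ϑ θ 0 - levelPoint μ K e (x + θ)))
    hab hlo0 hlohi (fun e he => contDiff_partnerBand_pp_angle hA hd hlo hhi ρ (heI e he).1 ϑ θ 1) (η := ‖pairSumPath μ K ρ ϑ θ 0‖) hs hc₀ hc₁
    (mul_pos hK₂0 hM) (fun e he x _ => ?_) (fun e he x _ hGe => ?_) hN ht hW hw0 hw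
  · have h := abs_deriv_partnerBand_pp_angle_le_chord hA hA20 hd hlo hhi hA₃ hA₄ hK₂ ρ (heI e he).1 ϑ θ x
    calc _ ≤ K₂ * ‖pairSumPath μ K ρ ϑ θ 0‖ * msD A₃ A₄ 1 := h
      _ = K₂ * msD A₃ A₄ 1 * ‖pairSumPath μ K ρ ϑ θ 0‖ := by ring
  · obtain ⟨her, her₀, he0⟩ := heI e he
    have hē : |frameLevel μ K (pairSumPath μ K ρ ϑ θ 0 - levelPoint μ K e (x + θ))| < r := by
      have h1 := abs_le.1 hGe
      have h2 := he.2
      rw [abs_lt]; constructor <;> nlinarith [abs_of_pos he0]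
    refine (abs_deriv_partnerBand_pp_angle_gt_cooper_chord hA hA20 hd hlo hhi hA₃ hA₄ hG her her₀ hē hs hGe hX ?_ ?_).le
    · have hmono : 2 * |e| / (B.Dtmin - 2 * A) ≤ 2 * hi / (B.Dtmin - 2 * A) := by
        refine div_le_div_of_nonneg_right ?_ hDt.le
        rw [abs_of_pos he0]; linarith [he.2]
      linarith
    · have hmono : 2 * |e| / (B.Dtmin - 2 * A) ≤ 2 * hi / (B.Dtmin - 2 * A) := by
        refine div_le_div_of_nonneg_right ?_ hDt.le
        rw [abs_of_pos he0]; linarith [he.2]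
      linarith

/-! ## §4 The Cooper logarithm of the chord is a logarithm of the tube angle, uniformly in the level `ρ` -/

omit hA20 hd hA₃ hA₄ hK₁ hK₂ in
/-- **`log⁺(hi/(ĉ₀s/2)) ≤ log⁺((π·hi/(ĉ₀u_min))/‖ϑ − π‖_𝕋)`** for `ϑ ≢ π (mod 2π)`: the chord dominates the tube angle (`s ≥ (2u_min/π)‖ϑ−π‖_𝕋`, part 2), so the
Cooper logarithm of §3 is the `ρ`-UNIFORM logarithm of the tube angle that `…C4aAbsBubbleLevelLoop.intervalIntegral_cooper_window_le` integrates. -/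
theorem posLog_chord_le_posLog_torusDist {ρ : ℝ} (hρ : |ρ| < r) {ϑ θ hi c₀ : ℝ} (hhi0 : 0 ≤ hi) (hc₀ : 0 < c₀) (hϑ : 0 < torusDist (ϑ - π)) :
    log⁺ (hi / (c₀ * ‖pairSumPath μ K ρ ϑ θ 0‖ / 2)) ≤
      log⁺ (π * hi / (c₀ * (bandBounds (show (-4 : ℝ) < -1.1 by norm_num) (show (-1.1 : ℝ) ≤ -0.1 by norm_num) (show (-0.1 : ℝ) < 0 by norm_num)).umin) /
        torusDist (ϑ - π)) := by
  set B := bandBounds (show (-4 : ℝ) < -1.1 by norm_num) (show (-1.1 : ℝ) ≤ -0.1 by norm_num) (show (-0.1 : ℝ) < 0 by norm_num) with hBdef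
  have hu := B.umin_pos
  have hch := torusDist_sub_pi_le_norm_pairSum hA hr hlo hhi hρ ϑ θ
  rw [← hBdef] at hch
  have hs : 0 < ‖pairSumPath μ K ρ ϑ θ 0‖ := lt_of_lt_of_le (by positivity) hch
  refine Real.posLog_le_posLog (by positivity) ?_
  rw [div_div, div_le_div_iff₀ (by positivity) (by positivity)]
  -- `hi·(ĉ₀u·‖ϑ−π‖) ≤ π·hi·(ĉ₀ s/2)` ⇐ `2u‖ϑ−π‖ ≤ π s`
  have h2 : 2 * B.umin * torusDist (ϑ - π) ≤ π * ‖pairSumPath μ K ρ ϑ θ 0‖ := by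
    -- `2u/π·d ≤ s` ⇒ `2u·d ≤ π·s`
    have h' : 2 * B.umin * torusDist (ϑ - π) = π * (2 * B.umin / π * torusDist (ϑ - π)) := by field_simp
    rw [h']; exact mul_le_mul_of_nonneg_left hch Real.pi_pos.le
  nlinarith [mul_le_mul_of_nonneg_left h2 (mul_nonneg hhi0 hc₀.le)]

end Sizes

end Summit.HubbardSuperconductivity.HubbardSuperconductivity.Theorems.C4a

end
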